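import Literature.Barriers.ValiantsHypothesis.GCTMatrixPoweringProofs
import Literature.RepresentationTheory.GeneralLinear.SchurFunctor
import HarnessLib

/-!
# Gesmundo–Ikenmeyer–Panova 2017, §3: columns, row-wise sums, and the positivity ingredients
# Prop. 15 (semigroup), Prop. 17 (columns), Prop. 18 (small shapes), Prop. 19 as named facts

Companion (D-0014) of `GCTMatrixPoweringProofs.lean`, which reduced GIP's Thm. 10 (`GIP2017_thm10`,
barrier `GCTMatrixPowering`) to the positivity statement Prop. 20 (`GIP2017_prop20`: `sm(λ, ℓ) > 0` off
an explicit list). GIP prove Prop. 20 in §3 (held text arXiv:1611.00827, pp. 9–12, flat numbering)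
by decomposing `λ` into its COLUMNS: "First, we prove it when `λ` is a single column. When `λ` has
more columns we apply the semigroup property to the sum of its columns to derive positivity." The
ingredients are

* **Prop. 15 (Semigroup properties)** for `sm(λ, n) = Σ_{ℓ(μ) ≤ n} sk(λ, μ)` and its skew twin
  `am(λ, n) = Σ_{ℓ(μ) ≤ n} ak(λ, μ)`, `ak(λ, μ) = dim([λ] ⊗ Λ²[μ])^{S_D}` the multiplicity of `[λ]`
  in the exterior square: "(1) If `sm(λ,n) > 0` and `sm(ν,n) > 0`, then
  `sm(λ+ν, n) ≥ max(sm(λ,n), sm(ν,n))`. (2) If `am(λ,n) > 0` and `am(ν,n) > 0`, then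
  `sm(λ+ν,n) ≥ max(am(λ,n), am(ν,n))`. (3) If `sm(λ,n) > 0` and `am(ν,n) > 0`, then
  `am(λ+ν,n) ≥ max(sm(λ,n), am(ν,n))`" (`λ + ν` the row-wise sum; proof by multiplying highest-weight
  vectors of `GL × GL` in `Sym^d(V ⊗ V^* ⊗ V)`).
* **Prop. 17 (columns)**: "Let `ℓ := max{⌊√a⌋ + 2, 12}`. We have that `sm(1^a, ℓ) > 0` if and only
  if `a ∉ X_s` and `am(1^a, ℓ) > 0` if and only if `a ∉ X_a`", `X_s = {2,3,4,7,8,12}`,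
  `X_a = {1,2,5,6,10,14}` (from Thm. 16 on `sk/ak` of a column against a self-conjugate partition
  and explicit self-conjugate partitions; the "only if" by direct calculation).
* **Prop. 18 (small shapes, computer-checked)**: "Let `λ` be a partition of length `ℓ ≤ 14` and
  `λ ∉ {(1^r) : r ∈ X_s} ∪ {(2,1,1), (3,1,1), (2,1⁷)}`. Then `sm(λ, 7) > 0`" ("We use a program
  written by Harm Derksen and adjusted by Jesko Hüttenhain"; direct computation for `λ₁ ≤ 3` and the
  semigroup property beyond). Its exceptional set is exactly `gipExceptionalShapes`.
* **Prop. 19**: "at least one of the two quantities is positive: `sm((2,2,1^a), ℓ) > 0` or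
  `am((2,2,1^a), ℓ) > 0`, where `ℓ = max{7, ⌈√(a+2)⌉}`" (from Cor. 38: `g(1^a + 1^b, ν, ν) > 0` for
  self-conjugate `ν` of large Durfee size, via Pak–Panova's strict unimodality of `q`-binomials).

**This file** (definitions and named facts; the deduction of Prop. 20 is the sibling proofs file
`GCTMatrixPoweringPositivity.lean`):

1. the column calculus used to run the printed argument: `colCount S r = #{c ∈ S : c > r}`, the
   length of row `r` of the shape with column lengths `S`; the identity
   `λ_{r+1} = colCount (λ').parts r` (`getD_sortedParts_eq_colCount_transpose`, rows from the
   columns `λ' = Nat.Partition.transpose λ` of the tree); the shape `ofColumns S` with prescribed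
   columns; `IsRowSum λ μ ν` ("`λ = μ + ν`", the row-wise sum `(μ₁+ν₁, μ₂+ν₂, …)` of GIP/IP, as a
   relation, so that partitions of different sizes need no casts; it is the graph of the tree's
   `Nat.Partition.rowAdd`, bridge `isRowSum_rowAdd` in the sibling proofs file); the rows of the
   column `(1^a)` (the tree's `Nat.Partition.column a`, `SchurFunctor.lean`) and the shape
   `twoTwoCol a = (2,2,1^a)`;
2. the skew side of the character calculus of `GCTMatrixPowering.lean`: `akCharSum λ μ =
   Σ_σ χ^λ(σ)(χ^μ(σ)² - χ^μ(σ²)) = 2·D!·ak(λ, μ)` (the character of `Λ²[μ]` is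
   `(χ^μ(σ)² - χ^μ(σ²))/2`), `AkPos`, `AmPos m λ` (`am(λ, m) > 0`);
3. the named facts `GIP2017_prop15` (positivity form), `GIP2017_prop17`, with the sets `gipXs`,
   `gipXa`; and the two statements `GIP2017_prop18`, `GIP2017_prop19` vendored verbatim from print,
   both REFUTED in the tree and **deprecated** (see *Verdict clean-up* below).

Rendering notes. Prop. 15 is vendored in its POSITIVITY form (the conclusions `> 0` that the printed
inequalities `≥ max(…)` give, `sm, am` being sums of multiplicities), which is all that §3 uses and
all that the character-sum rendering `SmPos`/`AmPos` expresses; Prop. 17 carries `1 ≤ a` (a column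
length; for `a = 0`, `am(∅, ℓ) = 0` although `0 ∉ X_a`); Prop. 19's `⌈√(a+2)⌉` is written
`⌊√(a+1)⌋ + 1` (`a + 2 ≥ 1`).

## Verdict clean-up (2026-08-15)

Two named facts of this file were vendored verbatim from GIP §3 (held text arXiv:1611.00827,
p. 11, ll. 4–5 and 21–22, re-read for this clean-up) and are FALSE AS PRINTED; each is refuted by a
kernel-checked theorem of the tree, its corrected form is stated and PROVED elsewhere in the tree,
and the `def` is kept byte-for-byte only because its refutation (and a few bookkeeping theorems)
must name it. Both carry `@[deprecated]`: no consumer may take either as a hypothesis (each is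
`False`), and no `GIP2017_prop18_holds` / `GIP2017_prop19_holds` can exist.

* `GIP2017_prop18` — **refuted as printed, deprecated.** The printed exceptional list of Prop. 18
  omits the hook `(2,1³) ⊢ 5` (length `4 ≤ 14`), for which `sm((2,1³), 7) = 0`. Refutation:
  `Literature.Barriers.ValiantsHypothesis.not_GIP2017_prop18`
  (`GCTMatrixPoweringErratumProofs.lean`; also `GIP2017_prop18_iff_false : GIP2017_prop18 ↔ False`,
  and the localisation `GIP2017_prop18_iff : GIP2017_prop18 ↔ GIP2017_prop18_corrected ∧
  SmPos 7 twoOneCube` of `GCTMatrixPoweringErratum.lean`). Corrected statement (ten-shape list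
  `gipExceptionalShapesCorrected = gipExceptionalShapes ∪ {(2,1³)}`):
  `Literature.Barriers.ValiantsHypothesis.GIP2017_prop18_corrected` (`GCTMatrixPoweringErratum.lean`),
  PROVED as `GIP2017_prop18_corrected_holds` (`GCTMatrixPoweringProp20Holds.lean`).
* `GIP2017_prop19` — **refuted as printed, deprecated.** The printed row bound
  `ℓ = max{7, ⌈√(a+2)⌉}` fails at every `a = s² - 2`, `s ≥ 7` (no self-conjugate `μ ⊢ a + 4` of
  length `≤ s` exists and every `g((2,2,1^a), μ, μ)`, `ℓ(μ) ≤ s`, vanishes). Refutation: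
  `Literature.Barriers.ValiantsHypothesis.GIP2017_prop19_false` (`GCTMatrixPoweringProp19False.lean`,
  instance `a = 47`; `GIP2017_prop19_fails` for all `s ≥ 7`). Corrected statement (one more row,
  `ℓ = max{7, ⌈√(a+2)⌉ + 1}`): `Literature.Barriers.ValiantsHypothesis.GIP2017_prop19_corrected`,
  PROVED as `GIP2017_prop19_corrected_holds` (`GCTMatrixPoweringProp19.lean`).

The barrier `GCTMatrixPowering` (= GIP Thm. 10) does not depend on either: it is proved
unconditionally in the tree (`GCTMatrixPowering_holds`, `GCTMatrixPoweringProp20Holds.lean`) through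
the corrected Props. 18, 19, 20 (`gctMatrixPowering_of_prop18`, `GCTMatrixPoweringProp17.lean`).

## References

* [GesmundoIkenmeyerPanova2017] F. Gesmundo, C. Ikenmeyer, G. Panova, *Geometric complexity theory
  and matrix powering*, Diff. Geom. Appl. 55 (2017) 106–127 = arXiv:1611.00827, §3 (Props. 15,
  17, 18, 19, 20; Thm. 16; `X_s`, `X_a`; (3.1) `g = sk + ak`), §6, §8 (Prop. 37, Cor. 38).
* [FultonYoungTableaux1997] W. Fulton, *Young Tableaux* (1997), §0 (conjugate partition, columns).
-/

noncomputable section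

open scoped BigOperators

namespace Literature.Barriers.ValiantsHypothesis

open Literature.NumberTheory.DiophantineGeometry Literature.Computability.Complexity Finset

/-! ### 1. Counting columns longer than `r` -/

section ColCount

/-- For a multiset `S` of column lengths, `colCount S r = #{c ∈ S : c > r}` is the number of
columns reaching row `r`, i.e. the length of row `r` (0-indexed) of the Young diagram whose columns
have lengths `S` (Fulton, *Young Tableaux*, §0: `λ_i = #{j : λ'_j ≥ i}`). [cite: FultonYoungTableaux1997, §0 (conjugate partition)] -/
def colCount (S : Multiset ℕ) (r : ℕ) : ℕ :=
  (S.filter fun c => r < c).card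

/-- Unfolding lemma for `colCount`. [folklore] -/
theorem colCount_def (S : Multiset ℕ) (r : ℕ) : colCount S r = (S.filter fun c => r < c).card :=
  rfl

/-- No columns, no rows. [folklore] -/
@[simp]
theorem colCount_zero (r : ℕ) : colCount 0 r = 0 := by
  simp [colCount]

/-- `colCount` is additive in the columns (row-wise sum = union of columns). [folklore] -/
theorem colCount_add (S T : Multiset ℕ) (r : ℕ) :
    colCount (S + T) r = colCount S r + colCount T r := by
  simp [colCount, Multiset.filter_add]

/-- One more column of length `c` adds `1` to the rows `r < c`. [folklore] -/
theorem colCount_cons (c : ℕ) (S : Multiset ℕ) (r : ℕ) :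
    colCount (c ::ₘ S) r = (if r < c then 1 else 0) + colCount S r := by
  unfold colCount
  by_cases h : r < c
  · rw [Multiset.filter_cons_of_pos _ h, Multiset.card_cons, if_pos h, add_comm]
  · rw [Multiset.filter_cons_of_neg _ h, if_neg h, zero_add]

/-- A single column of length `c` has rows `r < c` of length `1`. [folklore] -/
theorem colCount_singleton (c r : ℕ) : colCount {c} r = if r < c then 1 else 0 := by
  rw [← Multiset.cons_zero, colCount_cons, colCount_zero, add_zero]

/-- `n` columns of length `c`: rows `r < c` of length `n`. [folklore] -/
theorem colCount_replicate (n c r : ℕ) :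
    colCount (Multiset.replicate n c) r = if r < c then n else 0 := by
  induction n with
  | zero => simp
  | succ n ih =>
    rw [Multiset.replicate_succ, colCount_cons, ih]
    split_ifs <;> omega

/-- Rows get shorter: `colCount S` is weakly decreasing in `r`. [folklore] -/
theorem antitone_colCount (S : Multiset ℕ) : Antitone (colCount S) := by
  intro r r' h
  exact Multiset.card_le_card
    (Multiset.monotone_filter_right S fun c (hc : r' < c) => lt_of_le_of_lt h hc)

/-- Below the longest column there are no boxes: `colCount S r = 0` for `r ≥ max S`. [folklore] -/
theorem colCount_eq_zero_of_sup_le {S : Multiset ℕ} {r : ℕ} (h : S.sup ≤ r) : colCount S r = 0 := by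
  rw [colCount, Multiset.card_eq_zero, Multiset.filter_eq_nil]
  intro c hc hrc
  exact absurd (lt_of_lt_of_le hrc ((Multiset.le_sup hc).trans h)) (lt_irrefl r)

/-- If every column is longer than `r`, row `r` has one box per column. [folklore] -/
theorem colCount_eq_card_of_forall_lt {S : Multiset ℕ} {r : ℕ} (h : ∀ c ∈ S, r < c) :
    colCount S r = S.card := by
  rw [colCount, Multiset.filter_eq_self.mpr h]

/-- Row `r` is nonempty iff some column is longer than `r`. [folklore] -/
theorem colCount_pos_iff {S : Multiset ℕ} {r : ℕ} : 0 < colCount S r ↔ ∃ c ∈ S, r < c := by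
  rw [colCount, Multiset.card_pos_iff_exists_mem]
  simp only [Multiset.mem_filter]

/-- Row `r` is nonempty iff `r < max S`. [folklore] -/
theorem colCount_pos_iff_lt_sup {S : Multiset ℕ} {r : ℕ} : 0 < colCount S r ↔ r < S.sup := by
  rw [colCount_pos_iff]
  constructor
  · rintro ⟨c, hc, hrc⟩
    exact lt_of_lt_of_le hrc (Multiset.le_sup hc)
  · intro h
    by_contra hne
    exact absurd (Multiset.sup_le.mpr fun c hc => not_lt.mp fun hrc => hne ⟨c, hc, hrc⟩)
      (not_le.mpr h)

/-- Double counting: the rows of the shape with columns `S` have `Σ S` boxes in total (summing over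
any range of rows containing them all). [folklore] -/
theorem sum_range_colCount (S : Multiset ℕ) {L : ℕ} (hL : S.sup ≤ L) :
    ∑ r ∈ range L, colCount S r = S.sum := by
  induction S using Multiset.induction_on with
  | empty => simp
  | cons c S ih =>
    rw [Multiset.sup_cons, sup_le_iff] at hL
    simp_rw [colCount_cons]
    rw [Finset.sum_add_distrib, ih hL.2, Multiset.sum_cons, Finset.sum_boole]
    congr 1
    have hfilter : (range L).filter (fun r => r < c) = range c := by
      ext r
      simp only [Finset.mem_filter, Finset.mem_range]
      omega
    rw [hfilter, Finset.card_range]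
    rfl

end ColCount

/-! ### 2. Rows of a partition from its columns -/

section Rows

variable {d : ℕ}

/-- Row `r` of a partition is nonempty exactly for `r < ℓ(λ)`. [folklore] -/
theorem getD_sortedParts_pos_iff (μ : Nat.Partition d) (r : ℕ) :
    0 < μ.sortedParts.getD r 0 ↔ r < μ.parts.card := by
  rw [← Nat.Partition.length_sortedParts]
  by_cases hr : r < μ.sortedParts.length
  · rw [List.getD_eq_getElem _ _ hr]
    exact ⟨fun _ => hr, fun _ => μ.pos_of_mem_sortedParts (List.getElem_mem hr)⟩
  · rw [List.getD_eq_default _ _ (not_lt.mp hr)]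
    exact ⟨fun h => absurd h (lt_irrefl 0), fun h => absurd h hr⟩

/-- The number of parts is read off the rows: `ℓ(λ) = L` iff the nonempty rows are exactly the
rows `r < L`. [folklore] -/
theorem card_parts_eq_of_rows (μ : Nat.Partition d) {L : ℕ}
    (h : ∀ r, 0 < μ.sortedParts.getD r 0 ↔ r < L) : μ.parts.card = L := by
  have key : ∀ r, r < μ.parts.card ↔ r < L := fun r =>
    (getD_sortedParts_pos_iff μ r).symm.trans (h r)
  refine le_antisymm ?_ ?_
  · by_contra hlt
    exact lt_irrefl L ((key L).mp (not_le.mp hlt))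
  · by_contra hlt
    exact lt_irrefl _ ((key μ.parts.card).mpr (not_le.mp hlt))

/-- **Rows from columns.** Row `r` of `λ` has as many boxes as there are columns of `λ` longer than
`r`: `λ_{r+1} = #{j : λ'_j > r}`, with `λ' = Nat.Partition.transpose λ` the conjugate partition
(parts = column lengths). Fulton, *Young Tableaux*, §0. [cite: FultonYoungTableaux1997, §0 (conjugate partition)] -/
theorem getD_sortedParts_eq_colCount_transpose (μ : Nat.Partition d) (r : ℕ) :
    μ.sortedParts.getD r 0 = colCount μ.transpose.parts r := by
  classical
  set Y := μ.youngDiagram with hY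
  rw [← rowLen_youngDiagram μ r]
  have hparts : μ.transpose.parts = (range (Y.rowLen 0)).val.map Y.colLen := by
    have hfun : Y.transpose.rowLen = Y.colLen := funext Y.rowLen_transpose
    change ((Y.transpose.rowLens : List ℕ) : Multiset ℕ) = _
    rw [YoungDiagram.rowLens, YoungDiagram.colLen_transpose, hfun, Finset.range_val]
    rfl
  rw [colCount, hparts, Multiset.filter_map, Multiset.card_map]
  have key : ((range (Y.rowLen 0)).filter fun j => r < Y.colLen j) = range (Y.rowLen r) := by
    ext j
    simp only [Finset.mem_filter, Finset.mem_range, ← YoungDiagram.mem_iff_lt_colLen,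
      YoungDiagram.mem_iff_lt_rowLen]
    exact ⟨fun h => h.2, fun h => ⟨lt_of_lt_of_le h (Y.rowLen_anti 0 r (Nat.zero_le r)), h⟩⟩
  have hc := congrArg Finset.card key
  rw [Finset.card_range, ← Finset.card_val, Finset.filter_val] at hc
  exact hc.symm

/-- Column lengths are positive. [folklore] -/
theorem transpose_parts_pos (μ : Nat.Partition d) : ∀ c ∈ μ.transpose.parts, 0 < c :=
  fun _ hc => μ.transpose.parts_pos hc

/-- **The number of rows is the longest column**: `ℓ(λ) = λ'_1 = max λ'`. [cite: FultonYoungTableaux1997, §0 (conjugate partition)] -/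
theorem card_parts_eq_sup_transpose (μ : Nat.Partition d) : μ.parts.card = μ.transpose.parts.sup :=
  card_parts_eq_of_rows μ fun r => by
    rw [getD_sortedParts_eq_colCount_transpose, colCount_pos_iff_lt_sup]

/-- **The first row is the number of columns**: `λ_1 = ℓ(λ') = #λ'`. [cite: FultonYoungTableaux1997, §0 (conjugate partition)] -/
theorem sup_parts_eq_card_transpose (μ : Nat.Partition d) :
    μ.parts.sup = μ.transpose.parts.card := by
  rw [sup_parts_eq_getD_sortedParts, getD_sortedParts_eq_colCount_transpose,
    colCount_eq_card_of_forall_lt (transpose_parts_pos μ)]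

/-- The columns of `λ ⊢ d` have `d` boxes in total. [folklore] -/
theorem sum_transpose_parts (μ : Nat.Partition d) : μ.transpose.parts.sum = d :=
  μ.transpose.parts_sum

/-- Every column is at most as long as the number of rows: `λ'_j ≤ ℓ(λ)`. [folklore] -/
theorem le_card_parts_of_mem_transpose (μ : Nat.Partition d) {c : ℕ} (hc : c ∈ μ.transpose.parts) :
    c ≤ μ.parts.card := by
  rw [card_parts_eq_sup_transpose]
  exact Multiset.le_sup hc

end Rows

/-! ### 3. The shape with prescribed columns; columns and `(2,2,1^a)` -/

section OfColumns

/-- The partition with column lengths `S` (a multiset of naturals; zeros contribute nothing): its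
rows are `r ↦ colCount S r` (built with `partitionOfRows`). For `S` the columns of `λ` minus some of
them this is the shape GIP manipulate in §3 ("let `α` be the partition formed by the nonexceptional
columns of `λ`"). [cite: GesmundoIkenmeyerPanova2017, §3 (proof of Prop. 20)] -/
def ofColumns (S : Multiset ℕ) : Nat.Partition S.sum :=
  partitionOfRows (colCount S) S.sup S.sum

/-- The rows of `ofColumns S` are `colCount S`. [folklore] -/
theorem getD_sortedParts_ofColumns (S : Multiset ℕ) (r : ℕ) :
    (ofColumns S).sortedParts.getD r 0 = colCount S r := by
  rw [ofColumns,
    getD_sortedParts_partitionOfRows (antitone_colCount S) (sum_range_colCount S le_rfl)]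
  split_ifs with h
  · rfl
  · exact (colCount_eq_zero_of_sup_le (not_lt.mp h)).symm

/-- `ofColumns S` has `max S` rows. [folklore] -/
theorem card_parts_ofColumns (S : Multiset ℕ) : (ofColumns S).parts.card = S.sup :=
  card_parts_eq_of_rows _ fun r => by rw [getD_sortedParts_ofColumns, colCount_pos_iff_lt_sup]

/-- `ofColumns S` has first row `#S` when all prescribed columns are nonempty. [folklore] -/
theorem sup_parts_ofColumns {S : Multiset ℕ} (hS : ∀ c ∈ S, 0 < c) :
    (ofColumns S).parts.sup = S.card := by
  rw [sup_parts_eq_getD_sortedParts, getD_sortedParts_ofColumns, colCount_eq_card_of_forall_lt hS]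

/-- The sorted parts of the column `(1^a)` (the tree's `Nat.Partition.column a`, parts `a` ones;
GIP: "`λ` is a single column", `1^a`) are `[1, …, 1]`. [folklore] -/
theorem sortedParts_column (a : ℕ) : (Nat.Partition.column a).sortedParts = List.replicate a 1 := by
  change (Nat.Partition.column a).parts.sort (· ≥ ·) = _
  rw [Nat.Partition.column_parts, ← Multiset.coe_replicate, Multiset.coe_sort]
  exact List.mergeSort_eq_self _ (List.pairwise_replicate.mpr (Or.inr le_rfl))

/-- The rows of `(1^a)`: one box in each of the rows `r < a` — the rows of the shape with the single
column `a`. [folklore] -/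
theorem getD_sortedParts_column (a r : ℕ) :
    (Nat.Partition.column a).sortedParts.getD r 0 = colCount {a} r := by
  rw [sortedParts_column, colCount_singleton]
  by_cases h : r < a
  · rw [if_pos h, List.getD_eq_getElem _ _ (by simpa using h), List.getElem_replicate]
  · rw [if_neg h, List.getD_eq_default _ _ (by simpa using not_lt.mp h)]

/-- **The shape `(2,2,1^a)`** of Prop. 19 / Prop. 20 (parts `2, 2` and `a` parts `1`; columns of
lengths `a + 2` and `2`). [cite: GesmundoIkenmeyerPanova2017, Prop. 19 ((2,2,1^a))] -/
def twoTwoCol (a : ℕ) : Nat.Partition (a + 4) where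
  parts := 2 ::ₘ 2 ::ₘ Multiset.replicate a 1
  parts_pos h := by
    simp only [Multiset.mem_cons] at h
    rcases h with rfl | rfl | h
    · exact two_pos
    · exact two_pos
    · rw [Multiset.eq_of_mem_replicate h]; exact one_pos
  parts_sum := by
    simp only [Multiset.sum_cons, Multiset.sum_replicate, smul_eq_mul, mul_one]
    omega

/-- The parts of `(2,2,1^a)`. [folklore] -/
@[simp]
theorem twoTwoCol_parts (a : ℕ) : (twoTwoCol a).parts = 2 ::ₘ 2 ::ₘ Multiset.replicate a 1 :=
  rfl

/-- The sorted parts of `(2,2,1^a)` are `[2, 2, 1, …, 1]`. [folklore] -/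
theorem sortedParts_twoTwoCol (a : ℕ) :
    (twoTwoCol a).sortedParts = 2 :: 2 :: List.replicate a 1 := by
  change (2 ::ₘ 2 ::ₘ Multiset.replicate a 1).sort (· ≥ ·) = _
  rw [← Multiset.coe_replicate, Multiset.cons_coe, Multiset.cons_coe, Multiset.coe_sort]
  refine List.mergeSort_eq_self _ (List.pairwise_cons.mpr ⟨?_, List.pairwise_cons.mpr ⟨?_, ?_⟩⟩)
  · intro b hb
    simp only [List.mem_cons, List.mem_replicate] at hb
    omega
  · intro b hb
    rw [List.mem_replicate] at hb
    omega
  · exact List.pairwise_replicate.mpr (Or.inr le_rfl)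

/-- The rows of `(2,2,1^a)` are the rows of the shape with columns `a + 2` and `2`. [folklore] -/
theorem getD_sortedParts_twoTwoCol (a r : ℕ) :
    (twoTwoCol a).sortedParts.getD r 0 = colCount {a + 2, 2} r := by
  rw [sortedParts_twoTwoCol, Multiset.insert_eq_cons, colCount_cons, colCount_singleton]
  rcases r with _ | _ | r
  · simp
  · simp
  · rw [List.getD_cons_succ, List.getD_cons_succ]
    by_cases h : r < a
    · rw [List.getD_eq_getElem _ _ (by simpa using h), List.getElem_replicate, if_pos (by omega),
        if_neg (by omega)]
    · rw [List.getD_eq_default _ _ (by simpa using not_lt.mp h), if_neg (by omega),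
        if_neg (by omega)]

end OfColumns

/-! ### 4. Row-wise sums -/

section RowSum

/-- **`λ = μ + ν` (row-wise sum).** "Let `λ = (λ₁, λ₂, …)` and `μ = (μ₁, μ₂, …)` be partitions, then
`λ + μ` is defined as `(λ₁ + μ₁, λ₂ + μ₂, …)`" (GIP §2.1); equivalently the columns of the sum are
the columns of the summands together. Stated as a relation between partitions of any sizes: it is
the graph of the tree's operation `Nat.Partition.rowAdd` (`OccurrenceObstructionsIP.lean`, whose
`getD_sortedParts_rowAdd` reads `IsRowSum (μ.rowAdd ν) μ ν`); the bridge `isRowSum_rowAdd` is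
proved in the sibling proofs file `GCTMatrixPoweringPositivity.lean`, which imports both.
[cite: GesmundoIkenmeyerPanova2017, §2.1 (definition of λ+μ)] -/
def IsRowSum {c a b : ℕ} (lam : Nat.Partition c) (mu : Nat.Partition a) (nu : Nat.Partition b) :
    Prop :=
  ∀ r, lam.sortedParts.getD r 0 = mu.sortedParts.getD r 0 + nu.sortedParts.getD r 0

variable {c a b : ℕ}

/-- `λ = μ + ν ↔ λ = ν + μ`. [folklore] -/
theorem IsRowSum.symm {lam : Nat.Partition c} {mu : Nat.Partition a} {nu : Nat.Partition b}
    (h : IsRowSum lam mu nu) : IsRowSum lam nu mu :=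
  fun r => (h r).trans (add_comm _ _)

/-- A row-wise sum has `max(ℓ(μ), ℓ(ν))` parts. [folklore] -/
theorem IsRowSum.card_parts_eq {lam : Nat.Partition c} {mu : Nat.Partition a} {nu : Nat.Partition b}
    (h : IsRowSum lam mu nu) : lam.parts.card = max mu.parts.card nu.parts.card :=
  card_parts_eq_of_rows lam fun r => by
    rw [h r, lt_max_iff, ← getD_sortedParts_pos_iff, ← getD_sortedParts_pos_iff]
    omega

/-- **Splitting the columns splits the partition row-wise**: if the rows of `λ, μ, ν` are those of
the shapes with columns `S + T`, `S`, `T`, then `λ = μ + ν`. [folklore] -/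
theorem isRowSum_of_colCount {lam : Nat.Partition c} {mu : Nat.Partition a} {nu : Nat.Partition b}
    {S T : Multiset ℕ} (hlam : ∀ r, lam.sortedParts.getD r 0 = colCount (S + T) r)
    (hmu : ∀ r, mu.sortedParts.getD r 0 = colCount S r)
    (hnu : ∀ r, nu.sortedParts.getD r 0 = colCount T r) : IsRowSum lam mu nu :=
  fun r => by rw [hlam, hmu, hnu, colCount_add]

/-- In particular `λ = ofColumns S + ofColumns T` whenever the columns of `λ` are `S + T`. [folklore] -/
theorem isRowSum_ofColumns {d : ℕ} (lam : Nat.Partition d) {S T : Multiset ℕ}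
    (h : lam.transpose.parts = S + T) : IsRowSum lam (ofColumns S) (ofColumns T) :=
  isRowSum_of_colCount (fun r => by rw [getD_sortedParts_eq_colCount_transpose, h])
    (getD_sortedParts_ofColumns S) (getD_sortedParts_ofColumns T)

end RowSum

/-! ### 5. The skew side: `ak`, `am` through characters -/

section Skew

variable {D : ℕ}

/-- The character sum `Σ_{σ ∈ S_D} χ^λ(σ) · (χ^μ(σ)² - χ^μ(σ²))`, over `ℂ`: by the character of an
exterior square, `χ_{Λ²[μ]}(σ) = (χ^μ(σ)² - χ^μ(σ²))/2`, this equals `2 · D! · ak(λ, μ)` with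
`ak(λ, μ) = dim([λ] ⊗ Λ²[μ])^{S_D}` the multiplicity of `[λ]` in `Λ²[μ]` (skew twin of `skCharSum`;
GIP (3.1): `g(λ, μ, μ) = sk(λ, μ) + ak(λ, μ)`). [cite: GesmundoIkenmeyerPanova2017, §3 (ak, (3.1))] [cite: FultonHarrisGTM129, §2.1 and Ex. 4.51] -/
def akCharSum (lam μ : Nat.Partition D) : ℂ :=
  ∑ σ : Equiv.Perm (Fin D),
    spechtCharacter ℂ lam σ * (spechtCharacter ℂ μ σ ^ 2 - spechtCharacter ℂ μ (σ * σ))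

/-- `AkPos λ μ`: `ak(λ, μ) > 0`, rendered as `akCharSum λ μ ≠ 0` (`= 2·D!·ak(λ, μ)`), as `SkPos`.
[cite: GesmundoIkenmeyerPanova2017, §3 (ak)] -/
def AkPos (lam μ : Nat.Partition D) : Prop :=
  akCharSum lam μ ≠ 0

/-- `AmPos m λ`: GIP's `am(λ, m) := Σ_{μ : ℓ(μ) ≤ m} ak(λ, μ) > 0`, i.e. some `μ ⊢ |λ|` with at most `m`
parts has `ak(λ, μ) > 0` (as `SmPos`). [cite: GesmundoIkenmeyerPanova2017, §3 (definition of am)] -/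
def AmPos (m : ℕ) (lam : Nat.Partition D) : Prop :=
  ∃ μ : Nat.Partition D, μ.parts.card ≤ m ∧ AkPos lam μ

/-- Monotonicity of `am(λ, ·) > 0` in the number of rows allowed. [cite: GesmundoIkenmeyerPanova2017, §3 (definition of am)] -/
theorem AmPos.mono {lam : Nat.Partition D} {a b : ℕ} (hab : a ≤ b) (h : AmPos a lam) :
    AmPos b lam := by
  obtain ⟨μ, hμ, hak⟩ := h
  exact ⟨μ, hμ.trans hab, hak⟩

/-- `g = sk + ak` at the level of character sums: `skCharSum λ μ + akCharSum λ μ =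
2 Σ_σ χ^λ(σ) χ^μ(σ)²` (`= 2·D!·g(λ, μ, μ)` by the character formula for Kronecker coefficients),
GIP (3.1). [cite: GesmundoIkenmeyerPanova2017, §3 ((3.1))] -/
theorem skCharSum_add_akCharSum (lam μ : Nat.Partition D) :
    skCharSum lam μ + akCharSum lam μ =
      2 * ∑ σ : Equiv.Perm (Fin D), spechtCharacter ℂ lam σ * spechtCharacter ℂ μ σ ^ 2 := by
  rw [skCharSum, akCharSum, ← Finset.sum_add_distrib, Finset.mul_sum]
  refine Finset.sum_congr rfl fun σ _ => ?_
  ring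

end Skew

/-! ### 6. GIP's ingredients of Prop. 20, as named facts -/

/-- `X_s := {2, 3, 4, 7, 8, 12}`, the exceptional column lengths for `sm` (Prop. 17).
[cite: GesmundoIkenmeyerPanova2017, §3 (X_s, before Prop. 17)] -/
def gipXs : Finset ℕ :=
  {2, 3, 4, 7, 8, 12}

/-- `X_a := {1, 2, 5, 6, 10, 14}`, the exceptional column lengths for `am` (Prop. 17).
[cite: GesmundoIkenmeyerPanova2017, §3 (X_a, before Prop. 17)] -/
def gipXa : Finset ℕ :=
  {1, 2, 5, 6, 10, 14}

/-- The columns of the nine exceptional shapes of Prop. 18 / Prop. 20 that are single columns are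
exactly `{1^r : r ∈ X_s}`. [cite: GesmundoIkenmeyerPanova2017, Prop. 18] -/
theorem replicate_mem_gipExceptionalShapes_iff (r : ℕ) :
    Multiset.replicate r 1 ∈ gipExceptionalShapes ↔ r ∈ gipXs := by
  constructor
  · intro h
    rcases (mem_gipExceptionalShapes_iff _).mp h with h | h | h | h | h | h | h | h | h <;>
    · have hc := congrArg Multiset.card h
      simp only [Multiset.card_replicate, Multiset.insert_eq_cons, Multiset.card_cons,
        Multiset.card_singleton, Nat.reduceAdd] at hc
      subst hc
      decide
  · intro h
    simp only [gipXs, Finset.mem_insert, Finset.mem_singleton] at h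
    rcases h with rfl | rfl | rfl | rfl | rfl | rfl <;> simp [mem_gipExceptionalShapes_iff]

/-- **GIP Prop. 15 (Semigroup properties), positivity form — named fact.** "Let `λ` and `ν` be
partitions. We have (1) If `sm(λ,n) > 0` and `sm(ν,n) > 0`, then `sm(λ+ν,n) ≥ max(sm(λ,n), sm(ν,n))`.
(2) If `am(λ,n) > 0` and `am(ν,n) > 0`, then `sm(λ+ν,n) ≥ max(am(λ,n), am(ν,n))`. (3) If
`sm(λ,n) > 0` and `am(ν,n) > 0`, then `am(λ+ν,n) ≥ max(sm(λ,n), am(ν,n))`." Vendored as the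
positivity conclusions (`… > 0`, which the printed inequalities give since `sm, am ≥ 0` are sums of
multiplicities) for every row-wise sum `λ' = λ + ν` (`IsRowSum`) and every positive number of
rows `n` ("for any positive integer"), in the character rendering `SmPos`/`AmPos`. Printed proof:
multiply highest-weight vectors of `GL × GL` in `Sym^d(V ⊗ V^* ⊗ V)`, invariant/skew-invariant
under the `S₂` switching the two copies. [cite: GesmundoIkenmeyerPanova2017, Prop. 15] -/
def GIP2017_prop15 : Prop :=
  ∀ (n : ℕ), 0 < n → ∀ {c a b : ℕ} (lam : Nat.Partition c) (mu : Nat.Partition a)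
    (nu : Nat.Partition b), IsRowSum lam mu nu →
      (SmPos n mu → SmPos n nu → SmPos n lam) ∧ (AmPos n mu → AmPos n nu → SmPos n lam) ∧
        (SmPos n mu → AmPos n nu → AmPos n lam)

/-- **GIP Prop. 17 (columns) — named fact.** "Let `ℓ := max{⌊√a⌋ + 2, 12}`. We have that
`sm(1^a, ℓ) > 0` if and only if `a ∉ X_s` and `am(1^a, ℓ) > 0` if and only if `a ∉ X_a`", for a
column `1^a` (the tree's `Nat.Partition.column a`), `a ≥ 1` (for `a = 0` the `am` clause fails as
printed: `am(∅, ℓ) = 0` while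
`0 ∉ X_a`; columns have positive length). Printed proof: Thm. 16 (`sk(D×1, λ) = 1`, `ak = 0` if
`sgn(λ) = 1`, and conversely, for self-conjugate `λ`) with explicit self-conjugate partitions of
`a` with at most `ℓ` rows and prescribed sign; "a direct calculation shows that `sm(1^a, ℓ) = 0` for
`a ∈ X_s` and `am(1^a, ℓ) = 0` for `a ∈ X_a`". [cite: GesmundoIkenmeyerPanova2017, Prop. 17] -/
def GIP2017_prop17 : Prop :=
  ∀ a : ℕ, 1 ≤ a →
    (SmPos (max (Nat.sqrt a + 2) 12) (Nat.Partition.column a) ↔ a ∉ gipXs) ∧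
      (AmPos (max (Nat.sqrt a + 2) 12) (Nat.Partition.column a) ↔ a ∉ gipXa)

/-- **GIP Prop. 18 (small shapes; computer-checked) as printed — REFUTED, deprecated (verdict
clean-up 2026-08-15; no longer a named fact of the tree).** GIP, arXiv:1611.00827 p. 11 (= Diff.
Geom. Appl. 55 (2017), Prop. 3.5): "Let `λ` be a partition of length `ℓ ≤ 14` and
`λ ∉ {(1^r) : r ∈ X_s} ∪ {(2,1,1), (3,1,1), (2,1⁷)}`. Then `sm(λ, 7) > 0`." The excluded set is
`gipExceptionalShapes` (`replicate_mem_gipExceptionalShapes_iff`). Printed proof: "We use a program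
written by Harm Derksen and adjusted by Jesko Hüttenhain ... A direct computation for partitions
`λ` with `ℓ(λ) ≤ 12` and `λ₁ ≤ 3` shows that `sm(λ, 7) > 0` except for the cases listed above",
further direct computations, and the semigroup property for `λ₁ ≥ 4`.
**What is wrong:** the statement, vendored verbatim, is FALSE for the hook
`λ = (2,1,1,1) = (2,1³) ⊢ 5` (length `4 ≤ 14`, in neither printed list): `sk((2,1³), μ) = 0` for
all seven `μ ⊢ 5` — the irreducible `[2,1³] = V ⊗ sgn` of `𝔖₅` occurs in no symmetric square
`S²[μ]` (character table of `𝔖₅`, Fulton–Harris §3.1; `ak((2,1³), μ) = 1` for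
`μ = (3,2), (3,1,1), (2,2,1)`), so `sm((2,1³), 7) = 0` while `am((2,1³), 3) = 3`.
**Refutation (kernel-checked, kept):** `Literature.Barriers.ValiantsHypothesis.not_GIP2017_prop18 :
¬ GIP2017_prop18` (`GCTMatrixPoweringErratumProofs.lean`, by the verified Murnaghan–Nakayama
evaluator; also `GIP2017_prop18_iff_false : GIP2017_prop18 ↔ False` there, the conditional
`GIP2017_prop18_false : skTwoOneCubeVanishes → ¬ GIP2017_prop18` and the localisation
`GIP2017_prop18_iff : GIP2017_prop18 ↔ GIP2017_prop18_corrected ∧ SmPos 7 twoOneCube` of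
`GCTMatrixPoweringErratum.lean`).
**Corrected statement — use instead:** `Literature.Barriers.ValiantsHypothesis.GIP2017_prop18_corrected`
(`GCTMatrixPoweringErratum.lean`: the printed statement with the ten-shape list
`gipExceptionalShapesCorrected = gipExceptionalShapes ∪ {(2,1³)}`), PROVED in the tree as
`GIP2017_prop18_corrected_holds` (`GCTMatrixPoweringProp20Holds.lean`; its printed computer
calculation reduced to two- and three-column atoms by `GIP2017_prop18_corrected_of_atoms`,
`GCTMatrixPoweringProp18.lean`); it is all that Prop. 20 / Thm. 10 use
(`gctMatrixPowering_of_prop18`, `GCTMatrixPoweringProp17.lean`; `GCTMatrixPowering_holds`). The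
`def` below is kept verbatim only because its refutation names it; do not take
`(h : GIP2017_prop18)` as a hypothesis (it is `False`); no `GIP2017_prop18_holds` can exist.
[cite: GesmundoIkenmeyerPanova2017, Prop. 18 (p. 11, statement as printed; refuted)] -/
@[deprecated "refuted as printed (the exceptional list omits (2,1,1,1)): see Literature.Barriers.ValiantsHypothesis.not_GIP2017_prop18 (GCTMatrixPoweringErratumProofs.lean); corrected statement Literature.Barriers.ValiantsHypothesis.GIP2017_prop18_corrected (GCTMatrixPoweringErratum.lean), proved as GIP2017_prop18_corrected_holds (GCTMatrixPoweringProp20Holds.lean)" (since := "2026-08-15")]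
def GIP2017_prop18 : Prop :=
  ∀ (D : ℕ) (lam : Nat.Partition D), lam.parts.card ≤ 14 → lam.parts ∉ gipExceptionalShapes →
    SmPos 7 lam

/-- **GIP Prop. 19 as printed — REFUTED, deprecated (verdict clean-up 2026-08-15; no longer a
named fact of the tree).** GIP, arXiv:1611.00827 p. 11 (= Diff. Geom. Appl. 55 (2017), Prop. 3.6):
"We have that at least one of the two quantities is positive: `sm((2,2,1^a), ℓ) > 0` or
`am((2,2,1^a), ℓ) > 0`, where `ℓ = max{7, ⌈√(a+2)⌉}`" (with `⌈√(a+2)⌉ = ⌊√(a+1)⌋ + 1`,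
`sqrt_succ_succ_spec`). Printed proof: `Σ_{ℓ(μ) ≤ ℓ} g(λ, μ, μ) = sm(λ, ℓ) + am(λ, ℓ)` ((3.1)) and
`g((2,2,1^a), μ, μ) > 0` for a self-conjugate `μ ⊢ a + 4` of length `≤ ℓ` (Cor. 38, from Prop. 37
and Pak–Panova's strict unimodality of `q`-binomial coefficients).
**What is wrong:** the statement, vendored verbatim, is FALSE for `a = s² - 2`, `s ≥ 7` (then
`ℓ = s`; no self-conjugate `μ ⊢ a + 4 = s² + 2` of length `≤ s` exists, and
`g((2,2,1^a), μ, μ) = 0` for EVERY `μ ⊢ s² + 2` with `ℓ(μ) ≤ s`, `kroneckerCoeff_twoTwoCol_eq_zero`,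
so `sm((2,2,1^a), s) = am((2,2,1^a), s) = 0`, `not_smPos_twoTwoCol` / `not_amPos_twoTwoCol`); the
printed proof borrows the self-conjugate partitions of Prop. 17, which are partitions of `a` of
length `≤ ⌊√a⌋ + 2`, not of `a + 4` of length `≤ ⌈√(a+2)⌉`.
**Refutation (kernel-checked, kept):** `Literature.Barriers.ValiantsHypothesis.GIP2017_prop19_false :
¬ GIP2017_prop19` (`GCTMatrixPoweringProp19False.lean`, the instance `a = 47`, `ℓ = 7`;
`GIP2017_prop19_fails` for every `s ≥ 7`).
**Corrected statement — use instead:** `Literature.Barriers.ValiantsHypothesis.GIP2017_prop19_corrected`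
(`GCTMatrixPoweringProp19.lean`: the printed statement with one more row,
`ℓ = max{7, ⌈√(a+2)⌉ + 1}`, sharp along `a = s² - 2`), PROVED in the tree as
`GIP2017_prop19_corrected_holds`; it is all that Prop. 20 needs (which applies Prop. 19 at
`ℓ = max{⌈√L⌉ + 2, 12} ≥ ⌈√(a+2)⌉ + 2`; `gctMatrixPowering_of_prop18`, `GCTMatrixPoweringProp17.lean`;
`GCTMatrixPowering_holds`). The `def` below is kept verbatim only because its refutation names it;
do not take `(h : GIP2017_prop19)` as a hypothesis (it is `False`); no `GIP2017_prop19_holds` can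
exist. [cite: GesmundoIkenmeyerPanova2017, Prop. 19 (p. 11, statement as printed; refuted)] -/
@[deprecated "refuted as printed (the row bound max{7, ⌈√(a+2)⌉} fails at a = s²-2, s ≥ 7): see Literature.Barriers.ValiantsHypothesis.GIP2017_prop19_false (GCTMatrixPoweringProp19False.lean); corrected statement Literature.Barriers.ValiantsHypothesis.GIP2017_prop19_corrected (one more row), proved as GIP2017_prop19_corrected_holds (GCTMatrixPoweringProp19.lean)" (since := "2026-08-15")]
def GIP2017_prop19 : Prop :=
  ∀ a : ℕ, SmPos (max 7 (Nat.sqrt (a + 1) + 1)) (twoTwoCol a) ∨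
    AmPos (max 7 (Nat.sqrt (a + 1) + 1)) (twoTwoCol a)

/-- Sanity of the rendering of `⌈√(a+2)⌉`: `⌊√(a+1)⌋ + 1` is the least `s` with `a + 2 ≤ s²`.
[cite: GesmundoIkenmeyerPanova2017, Prop. 19 (ℓ = max{7, ⌈√(a+2)⌉})] -/
theorem sqrt_succ_succ_spec (a : ℕ) :
    a + 2 ≤ (Nat.sqrt (a + 1) + 1) ^ 2 ∧ (Nat.sqrt (a + 1)) ^ 2 < a + 2 := by
  constructor
  · have h1 : a + 1 < (Nat.sqrt (a + 1) + 1) ^ 2 := Nat.lt_succ_sqrt' (a + 1)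
    omega
  · have h2 := Nat.sqrt_le' (a + 1)
    omega

end Literature.Barriers.ValiantsHypothesis

end
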